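import Literature.MathematicalPhysics.QuantumFieldTheory.Balaban1983to89.Node00.CarriersB8SubBP
import Literature.MathematicalPhysics.QuantumFieldTheory.Balaban1983to89.Node00.CarriersB8CubePrint

/-!
# NODE 00 (YM-PLAN Track A) — THE CUT RESIDUAL LAYER OF THE [B8″P] PIN WITH PROPOSITION 6's MEMBERS ON PRINT'S p. 98 CUBE CLASS:
# `ResidB8.cutSubBP λ J lan c₁ ρ₀` (`cub := fun j : IdxB8SubB θ => zdCubP θ.𝔸 θ.L ρ₀ j.1.1`) and the `rfl` reading of n05-w1's slot `B8LeafOfRecordSubBP` there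
# (definition + `rfl` faces only; the slot's eight-binder constructor with `p6` DISCHARGED is the companion proof file `B8LeafOfRecordSubBPCutPFields8`)

[Balaban1985RegularSpaces] = T. Bałaban, *Spaces of regular gauge field configurations on a lattice and gauge fixing conditions*, Commun. Math. Phys. **99**
(1985) 75–102 — Prop. 6 p. 99 ((1.135)–(1.138)), p. 98 (the cubes of Prop. 6: «a union of cubes of the size R₁M₁Lʲη, where R₁, M₁ are smallest integers for which
all the theorems of the papers [2, 4] are valid … M is a multiple of R₁M₁ … □_j is a sum of the big blocks of the lattice T_{L^{−j}}»), Lemma 1 p. 79 – Thm 8 p. 101.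
PDF held: `paper:balaban1985-cmp99-regular-spaces-gauge-fixing` (journal page = PDF page + 74).

WHY THIS MODULE (cell `pub-ymgap`, HUMAN RULING D-0062 Track A, node N05 = [B8]; seat `pub-ymgap-dag-n05-e` g11, row s3b — Proposition 6's cube road; an ADDITIVE importing
module: n05-w1's `Node00/CarriersB8SubBP`, dag-n05-d's `Node00/CarriersB8SubB` (`ResidB8.cutSubB`), k0-s2-w2's `Node00/CarriersB8CubePrint` (`zdCubP`) untouched and CONSUMED
BY NAME).  The N05 knits of record conclude the re-pinned slot `B8LeafOfRecordSubBP θ (λ.cutSubB J lan c₁)` (dag-n05-d D9b `…N05SubBPKnitGammaPrime`, p596490), whose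
Proposition-6 members are `fun j : IdxB8SubB θ => cubB8OfRecord θ j.1 = zdCub θ.𝔸 θ.L j.1.1` — Proposition 6 over ALL of NODE 00's `CubeB8` cubes, thin collars
`ρ = L` and ragged sides included (LOCATED-CARRIER, dag-n05-e g9 ∕ k0-s2-w2 `K0Stub2DatumForm`: WIDER than print's p. 98 class; no print-faithful supplier serves it), so
`p6` stays a DISPLAYED hypothesis of every such knit.  On print's class the family-level sentence IS a tree theorem for every `θ.D ≥ 2`, odd `θ.L ≥ 5`
(`B8Prop6PrintedZdCubPGamma.p6_residB8_of_zdCubP`, p596570: Fγ11 ∘ junction, unconditional).  THIS MODULE types the cut layer keyed on print's class: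

* **`ResidB8.cutSubBP λ J lan c₁ ρ₀`** := `λ.cutSubB J lan c₁` with `cub := fun j : IdxB8SubB θ => zdCubP θ.𝔸 θ.L ρ₀ j.1.1` (Proposition 6's members = the PRINT
  cubes at big-block size `ρ₀` inside the law members' ambient families; Prop. 5's carriers `lan : J → LandauData`, threshold `c₁`; Hölder data, axial map, [B9]
  inputs and the shared constants unchanged); its `rfl` field faces; `ResidB8.cutSubBP_withCub_eq` (re-pointing `cub` back gives `cutSubB`); the `Iff.rfl` reading
  `b8LeafOfRecordSubBP_cutSubBP_iff` of n05-w1's slot at this layer (Prop. 6's conjunct reads `B8.Prop6Printed θ.D θ.L λ.B₁ c₁ (fun j => zdCubP θ.𝔸 θ.L ρ₀ j.1.1)`).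
The companion PROOF file `B8LeafOfRecordSubBPCutPFields8` carries: the conjunct-by-conjunct reading, FULL cut ⇒ PRINT-CLASS cut at every `ρ₀`, and ★★★ the slot's
constructor at this layer from EIGHT binders (`l1 t2 p3 t4 p5e p5u p7 t8`) with `p6` SUPPLIED by p596570.

HONEST FRAMING: ONE definition (a field re-pointing of dag-n05-d's cut layer) and `rfl` bookkeeping — nothing of [Balaban1985RegularSpaces] is asserted or discharged
here; which cut layer the record's ∃-currency names is NODE 00's ∕ the planners' ∕ dag-n05-d's call, not this file's; N05 NOT discharged; counts unmoved (typed 28∕28 ·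
discharged 5∕27); one finite T⁴ programme at fixed ε, Bałaban as printed — NOT continuum ∕ ℝ⁴ ∕ infinite volume ∕ OS ∕ mass gap ∕ Clay.
No `sorry`, no `axiom`, no `opaque`, no `instance`, no `notation`.  Unit `pub-ymgap-dag-n05-e` (g11), 2026-08-28.
-/

noncomputable section

namespace Literature.MathematicalPhysics.QuantumFieldTheory.Balaban1983to89.Node00

open DagBinding
open B8LeafKnitRS (B8LeafRS)
open B8LeafModelZd (ZdIdx)
open B8Lemma1NonAbelian (blockPairNA)
open B8IdxB8LawsB (IdxB8LawsB IdxB8SubB)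

variable {θ : Stage3Params}

/-- **THE CUT RESIDUAL LAYER WITH PROPOSITION 6's MEMBERS ON PRINT'S p. 98 CUBE CLASS**: dag-n05-d's `λ.cutSubB J lan c₁` (Prop. 5's carriers re-pointed to
`lan : J → LandauData`, threshold `c₁` named, Prop. 6's index the four-law sub-index `IdxB8SubB θ`) with Proposition 6's members RE-POINTED from `cubB8OfRecord θ j.1`
(ALL `CubeB8` cubes) to k0-s2-w2's print-class member `zdCubP θ.𝔸 θ.L ρ₀ j.1.1` (the cubes `c` with `ρ₀ ∣ c.ρ`, `ρ₀ ∣ c.M`, corners on the `ρ₀`-grid — print's «M is a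
multiple of R₁M₁ … □_j is a sum of the big blocks»); the big-block size `ρ₀ = R₁M₁` is a parameter of the layer.  Hölder data, axial map, [B9] inputs, constants unchanged.
[cite: Balaban1985RegularSpaces, Prop. 6 p.99, p.98 («R₁, M₁ are smallest integers for which all the theorems of the papers [2, 4] are valid»), Prop. 5 p.94, Thm 2 p.83 («There exist constants B₁, B₂(β₀), c₁»)] -/
def ResidB8.cutSubBP (lam : ResidB8 θ) (J : Type) (lan : J → B8.LandauData) (c₁ : ℝ) (ρ₀ : ℕ) : ResidB8 θ :=
  { lam.cutSubB J lan c₁ with I8d := IdxB8SubB θ, cub := fun j : IdxB8SubB θ => zdCubP θ.𝔸 θ.L ρ₀ j.1.1 }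

/-- The print-class cut layer's Proposition-6 index is the four-law sub-index `IdxB8SubB θ`. [cite: Balaban1985RegularSpaces, Prop. 6 p.99 (bookkeeping)] -/
theorem ResidB8.cutSubBP_I8d (lam : ResidB8 θ) (J : Type) (lan : J → B8.LandauData) (c₁ : ℝ) (ρ₀ : ℕ) :
    (lam.cutSubBP J lan c₁ ρ₀).I8d = IdxB8SubB θ := rfl

/-- The print-class cut layer's Proposition-6 members are the print cubes at `ρ₀`: `cub = fun j => zdCubP θ.𝔸 θ.L ρ₀ j.1.1`.
[cite: Balaban1985RegularSpaces, Prop. 6 p.99, p.98 (bookkeeping)] -/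
theorem ResidB8.cutSubBP_cub (lam : ResidB8 θ) (J : Type) (lan : J → B8.LandauData) (c₁ : ℝ) (ρ₀ : ℕ) :
    (lam.cutSubBP J lan c₁ ρ₀).cub = (fun j : IdxB8SubB θ => zdCubP θ.𝔸 θ.L ρ₀ j.1.1) := rfl

/-- The print-class cut layer's Proposition-5 index is `J`. [cite: Balaban1985RegularSpaces, Prop. 5 p.94 (bookkeeping)] -/
theorem ResidB8.cutSubBP_I8c (lam : ResidB8 θ) (J : Type) (lan : J → B8.LandauData) (c₁ : ℝ) (ρ₀ : ℕ) :
    (lam.cutSubBP J lan c₁ ρ₀).I8c = J := rfl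

/-- The print-class cut layer's Proposition-5 members are `lan`. [cite: Balaban1985RegularSpaces, Prop. 5 p.94 (bookkeeping)] -/
theorem ResidB8.cutSubBP_lan (lam : ResidB8 θ) (J : Type) (lan : J → B8.LandauData) (c₁ : ℝ) (ρ₀ : ℕ) :
    (lam.cutSubBP J lan c₁ ρ₀).lan = lan := rfl

/-- The print-class cut layer's threshold is `c₁`. [cite: Balaban1985RegularSpaces, Thm 2 p.83, Prop. 6 p.99 (bookkeeping)] -/
theorem ResidB8.cutSubBP_c₁ (lam : ResidB8 θ) (J : Type) (lan : J → B8.LandauData) (c₁ : ℝ) (ρ₀ : ℕ) :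
    (lam.cutSubBP J lan c₁ ρ₀).c₁ = c₁ := rfl

/-- The cut leaves `B₁` unchanged. [cite: Balaban1985RegularSpaces, Thm 2 p.83, (1.136) p.99 (bookkeeping)] -/
theorem ResidB8.cutSubBP_B₁ (lam : ResidB8 θ) (J : Type) (lan : J → B8.LandauData) (c₁ : ℝ) (ρ₀ : ℕ) :
    (lam.cutSubBP J lan c₁ ρ₀).B₁ = lam.B₁ := rfl

/-- The cut leaves the Thm-4 constant `B₁′` unchanged. [cite: Balaban1985RegularSpaces, Thm 4 p.88 (bookkeeping)] -/
theorem ResidB8.cutSubBP_B₁' (lam : ResidB8 θ) (J : Type) (lan : J → B8.LandauData) (c₁ : ℝ) (ρ₀ : ℕ) :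
    (lam.cutSubBP J lan c₁ ρ₀).B₁' = lam.B₁' := rfl

/-- The cut leaves `B₂` unchanged. [cite: Balaban1985RegularSpaces, Thm 2 p.83 (bookkeeping)] -/
theorem ResidB8.cutSubBP_B₂ (lam : ResidB8 θ) (J : Type) (lan : J → B8.LandauData) (c₁ : ℝ) (ρ₀ : ℕ) :
    (lam.cutSubBP J lan c₁ ρ₀).B₂ = lam.B₂ := rfl

/-- The cut leaves the (1.61)-constant `C₂` unchanged. [cite: Balaban1985RegularSpaces, Prop. 3 p.87 (bookkeeping)] -/
theorem ResidB8.cutSubBP_C₂ (lam : ResidB8 θ) (J : Type) (lan : J → B8.LandauData) (c₁ : ℝ) (ρ₀ : ℕ) :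
    (lam.cutSubBP J lan c₁ ρ₀).C₂ = lam.C₂ := rfl

/-- The cut leaves the [B9] inputs unchanged. [cite: Balaban1985RegularSpaces, Prop. 5 p.94 (bookkeeping)] -/
theorem ResidB8.cutSubBP_inp (lam : ResidB8 θ) (J : Type) (lan : J → B8.LandauData) (c₁ : ℝ) (ρ₀ : ℕ) :
    (lam.cutSubBP J lan c₁ ρ₀).inp = lam.inp := rfl

/-- The cut leaves `B₀(β₀)` unchanged. [cite: Balaban1985RegularSpaces, Thm 2 p.83 (bookkeeping)] -/
theorem ResidB8.cutSubBP_B₀β (lam : ResidB8 θ) (J : Type) (lan : J → B8.LandauData) (c₁ : ℝ) (ρ₀ : ℕ) :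
    (lam.cutSubBP J lan c₁ ρ₀).B₀β = lam.B₀β := rfl

/-- The cut leaves the Hölder exponent unchanged. [cite: Balaban1985RegularSpaces, Thm 2 p.83 (bookkeeping)] -/
theorem ResidB8.cutSubBP_β (lam : ResidB8 θ) (J : Type) (lan : J → B8.LandauData) (c₁ : ℝ) (ρ₀ : ℕ) :
    (lam.cutSubBP J lan c₁ ρ₀).β = lam.β := rfl

/-- The cut leaves the length function unchanged. [cite: Balaban1985RegularSpaces, Thm 2 p.83 (bookkeeping)] -/
theorem ResidB8.cutSubBP_len (lam : ResidB8 θ) (J : Type) (lan : J → B8.LandauData) (c₁ : ℝ) (ρ₀ : ℕ) :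
    (lam.cutSubBP J lan c₁ ρ₀).len = lam.len := rfl

/-- The cut leaves Proposition 7's axial map unchanged. [cite: Balaban1985RegularSpaces, Prop. 7 p.100 (bookkeeping)] -/
theorem ResidB8.cutSubBP_toAxial (lam : ResidB8 θ) (J : Type) (lan : J → B8.LandauData) (c₁ : ℝ) (ρ₀ : ℕ) :
    (lam.cutSubBP J lan c₁ ρ₀).toAxial = lam.toAxial := rfl

/-- The print-class cut and dag-n05-d's cut differ ONLY in Proposition 6's members: re-pointing `cub` back to `cubB8OfRecord θ ·.1` recovers `λ.cutSubB J lan c₁` (`rfl`).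
[cite: Balaban1985RegularSpaces, Prop. 6 p.99 (bookkeeping)] -/
theorem ResidB8.cutSubBP_withCub_eq (lam : ResidB8 θ) (J : Type) (lan : J → B8.LandauData) (c₁ : ℝ) (ρ₀ : ℕ) :
    ({ lam.cutSubBP J lan c₁ ρ₀ with I8d := IdxB8SubB θ, cub := fun j : IdxB8SubB θ => cubB8OfRecord θ j.1 } : ResidB8 θ) = lam.cutSubB J lan c₁ := rfl

/-- **THE P-SLOT AT THE PRINT-CLASS CUT LAYER READS** (`Iff.rfl`): `B8LeafOfRecordSubBP θ (λ.cutSubBP J lan c₁ ρ₀)` is the surviving leaf over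
`famB8OfRecordSubBP θ λ.β λ.len`, Prop. 5 at `lan`, Prop. 6 at `fun j : IdxB8SubB θ => zdCubP θ.𝔸 θ.L ρ₀ j.1.1`, the axial map through `·.1`, threshold `c₁`.
[cite: Balaban1985RegularSpaces, Lemma 1 – Thm 8 pp.79–101 (bookkeeping)] -/
theorem b8LeafOfRecordSubBP_cutSubBP_iff (lam : ResidB8 θ) (J : Type) (lan : J → B8.LandauData) (c₁ : ℝ) (ρ₀ : ℕ) :
    B8LeafOfRecordSubBP θ (lam.cutSubBP J lan c₁ ρ₀) ↔
      B8LeafRS θ.D (θ.L : ℝ) lam.C₂ lam.B₁' lam.inp.B₀' lam.B₁ lam.B₂ c₁ lam.inp lam.B₀β (blockPairNA θ.D θ.L θ.𝔸)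
        (fun j : IdxB8SubB θ => famB8OfRecordSubBP θ lam.β lam.len j) lan (fun j : IdxB8SubB θ => zdCubP θ.𝔸 θ.L ρ₀ j.1.1)
        (fun j => lam.toAxial j.1) :=
  Iff.rfl

end Literature.MathematicalPhysics.QuantumFieldTheory.Balaban1983to89.Node00

end
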